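import Mathlib
import HarnessLib
import Summits.Ventures.LatticeQCDFlow.Exactness.LazyRelaxationLagLaw

/-!
# AR1SwitchingLaw — the exactly solvable AR(1) switching model: Bonanno et al.'s
# `ESS = exp(−k′ n_dof/n_step)` holds with `k′ = Δ²(1+ρ)/(1−ρ) = Δ² · 2τ_int`, up to an explicit
# `O(n_dof/n_step²)` correction, and `Var W = 2⟨W_d⟩` exactly

HONEST FRAMING: exact (Metropolis-corrected) sampling algorithms for lattice gauge theory;
figures of merit are autocorrelation/cost numbers at stated couplings and volumes; no
continuum-physics claim.

Venture `LatticeQCDFlow` (cell pub-lqcd), topic `Scaling`; FANOUT row 19 (`su2-snf`, GEN-4: family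
C = defect / OBC→PBC non-equilibrium evolutions of 4D SU(2), levers `protocol.n_step`,
`protocol.n_between`, deliverable "exponent of cost at fixed ESS").  OUR WORK, elementary finite
sums; nothing is cited as a fact.  MECHANISM CLASS KNOWN (not typed, not claimed as new): the
dragged harmonic trap has Gaussian work with variance twice the mean dissipation (Mazonka–Jarzynski
1999, continuous time); in linear response the excess work of a slow protocol is the squared
thermodynamic length weighted by the relaxation time of the conjugate observable (Sivak–Crooks
2012; Crooks 2007).  NEW HERE: the discrete-time, stepwise (annealed-importance-sampling /
NE-MCMC) version solved at every `n_step` and every autoregression `ρ ∈ [−1, 1]`, typed.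

## Why (the empirical law this models)

Bonanno–Bulgarelli–Cellini–Nada–Panfalone–Vadacchino–Verzichelli, arXiv:2510.25704 §3.1, FIT
`ÊSS = exp(−k′ n_dof/n_step)` (their eq. (3.9)) to 4D SU(3) OBC→PBC evolutions and derive the
`n_dof/n_step` collapse heuristically from linear response ("we assume … `⟨P_d⟩_eq − ⟨P_d⟩_NE ∼
1/n_step`", eq. (3.5)–(3.8), with an unexplained residual factor `K(β)`).  Row 19 measures the same
`k′` for SU(2) (`k′_W` of CARD-su2-snf §3).  The tree prices the law once GIVEN (T2-F
`Scaling/NonEquilibrium`, GEN-3's `Scaling/NonEquilibriumOverhead`) and proves its perfect-relaxation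
form (T2-W / row 8's `QuasiStaticFloorLaw`: `k′ = Δ²`) and the lazy-layer lag law
(`Exactness/LazyRelaxationLagLaw`, finite spaces, laziness `ε ≥ 0`; "for a general reversible layer
the linear-response form … is NOT typed here").  This file supplies a dynamics in which the law,
the value of `k′`, and its dependence on the layer's autocorrelation are theorems.

## The model (one degree of freedom; `n_dof` independent copies add up)

A real coordinate `y` in a unit-width harmonic trap dragged through positions `m_0, …, m_n`
(steps `d_k = m_{k+1} − m_k`; uniform protocol `m_k = kΔ/n`): actions `S_k(y) = (y − m_k)²/2`, Gibbs
laws `N(m_k, 1)`, `Z_k` constant so `ΔF = 0` and all work is dissipated.  The evolution starts in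
equilibrium, `y_0 ∼ N(m_0, 1)`; step `k < n` SWITCHES `S_k → S_{k+1}` at fixed `y_k`, paying
`w_k = S_{k+1}(y_k) − S_k(y_k) = d_k (m_k − y_k) + d_k²/2`, then applies ONE layer reversible for
`N(m_{k+1}, 1)`: the autoregression `y_{k+1} = m_{k+1} + ρ (y_k − m_{k+1}) + √(1−ρ²) ξ_{k+1}`
(`ρ = 0` heat bath = perfect relaxation; `0 < ρ < 1` an under-relaxed / partial sweep; `ρ < 0`
over-relaxation à la Adler; `ρ = −1` the deterministic reflection; `ρ = 1` no update).  Then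
`W = Σ_{k<n} w_k` is Gaussian; the LAG `e_k := m_k − E y_k` obeys `e_0 = 0`,
`e_{k+1} = ρ (e_k + d_k)` — VERBATIM row 8's `Exactness.lagSeq ρ d` with the laziness replaced by
the autoregression coefficient — and `Cov(y_j, y_k) = ρ^{|j−k|}`.  Hence, by linearity of the mean
and bilinearity of the covariance,

  `⟨W⟩ = Σ_{k<n} (d_k²/2 + d_k e_k)`  (`ar1MeanWork`),  `Var W = Σ_{j,k<n} d_j d_k ρ^{|j−k|}`  (`ar1WorkVar`).

In THIS file these two finite sums are the primitives (definitions); everything below is proved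
about them.  With Gaussian work the population Kish ESS is `exp(−Var W)` (the tree's dictionary
`Theory2.gaussianWork_kishESS`, `Scaling/GaussianWorkDictionary`), and `n_dof` independent dragged
coordinates add their variances: `−log ESS = n_dof · Var W₁` (`ar1NegLogESS`).

## Content (all proved; `ρ Δ N : ℝ`, `d : ℕ → ℝ`, `n : ℕ`)

* §1 `ar1WorkVar_eq_two_mul_meanWork` — **`Var W = 2⟨W⟩` for EVERY trap path and EVERY `ρ`**:
  the Gaussian-work relation `⟨W_d⟩ = s/2` DERIVED from the dynamics (row by row: the new
  covariance row `Σ_{j<n} ρ^{n−j} d_j` IS the lag `e_n`, `lagSeq_eq_sum`).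
* §2 uniform protocol, closed forms: `(1−ρ) e_k = (Δ/n) ρ (1−ρ^k)` (`lagSeq_const_mul`),
  **`⟨W⟩ = Δ²(1+ρ)/(2n(1−ρ)) − Δ²ρ(1−ρ^n)/(n²(1−ρ)²)`** (`ar1MeanWork_uniform`; division-free
  form `ar1MeanWork_const_mul` valid at `ρ = 1` too), `Var W` = twice that (`ar1WorkVar_uniform`).
  The leading term is EXACTLY `2τ_int` times the quasi-static floor `Δ²/(2n)`: row 8's
  `lazyDissipation_uniform_le_tauInt` ("at most `2τ_int(D)` times the floor") is sharp here.
* §3 THE LAW: `kPrime Δ ρ = Δ²(1+ρ)/(1−ρ)`, `kPrime_eq_tauInt` (`= Δ² · 2·Scoring.tauInt (ρ^·)`,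
  the scorers' calibration truth C-1), `kPrime_rho_zero` (`= Δ²`, perfect relaxation),
  `kPrime_lt_kPrime` (strictly increasing in `ρ`), `kPrime_lt_sq_iff` (`k′ < Δ² ↔ ρ < 0`:
  over-relaxation beats perfect relaxation to leading order, under-relaxation loses);
  **`ar1NegLogESS_eq`**: `−log ESS = k′ n_dof/n − n_dof · 2Δ²ρ(1−ρ^n)/(n²(1−ρ)²)`; for
  `0 ≤ ρ < 1` the printed law is a FLOOR on the ESS, sharp to `O(n_dof/n²)` (`ar1NegLogESS_le`,
  `ar1NegLogESS_ge`, `exp_neg_kPrime_le_ess`); for `−1 ≤ ρ ≤ 0` a CEILING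
  (`ar1NegLogESS_ge_of_nonpos`); and the COLLAPSE `n · (−log ESS) → k′ · n_dof`
  (`tendsto_ar1NegLogESS`, every `|ρ| < 1`): asymptotically the ESS depends on `n_step/n_dof` alone.

Reading for E7 / row 19 (value-free, a property of the model only): `k′` factorises as (squared
displacement per degree of freedom in units of the equilibrium width) × (`2τ_int` of the switch
observable under ONE protocol layer); the paper's residual `K(β)` is, in the model, that product's
coupling dependence; `n_between` does not enter a single evolution's ESS (the prior is sampled
exactly), as in E7's footnote to eq. (4.2); an over-relaxation admixture (`ρ < 0`) lowers `k′` below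
the perfect-relaxation value.  NOT CLAIMED: anything about the SU(2)/SU(3) heat-bath /
over-relaxation kernels or the lattice work distribution (not Gaussian at finite volume), any
measured number, optimal protocols, coupled degrees of freedom.  Endpoint and ordering statements
(`ρ = 0, ±1`, second law, echo cancellation at `ρ = −1`) are kept for a companion file.
-/

namespace Summit.Ventures.LatticeQCDFlow.Scaling

open Finset Filter Topology
open Summit.Ventures.LatticeQCDFlow.Exactness (lagSeq lagSeq_succ lagSeq_eq_sum sum_lagSeq_eq)
open Summit.Ventures.LatticeQCDFlow.Scoring (tauInt tauInt_geometric)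

/-! ## §1 The model's two moments as finite sums, and the fluctuation–dissipation identity -/

/-- Mean work `⟨W⟩ = Σ_{k<n} (d_k²/2 + d_k e_k)` of the AR(1) switching model along the trap steps
`d` (`ΔF = 0`, so this is the mean DISSIPATED work): the quasi-static part `Σ d_k²/2` plus the work
done against the lag `e_k = lagSeq ρ d k` of the mean behind the trap. -/
noncomputable def ar1MeanWork (ρ : ℝ) (d : ℕ → ℝ) (n : ℕ) : ℝ :=
  ∑ k ∈ range n, (d k ^ 2 / 2 + d k * lagSeq ρ d k)

/-- Variance of the work `Var W = Σ_{j,k<n} d_j d_k ρ^{|j−k|}`: the quadratic form of the steps in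
the stationary AR(1) autocovariance `ρ^{|j−k|}`. -/
noncomputable def ar1WorkVar (ρ : ℝ) (d : ℕ → ℝ) (n : ℕ) : ℝ :=
  ∑ j ∈ range n, ∑ k ∈ range n, d j * d k * ρ ^ Nat.dist j k

/-- One more step adds a row, a column and a corner to the covariance form. -/
theorem ar1WorkVar_succ (ρ : ℝ) (d : ℕ → ℝ) (n : ℕ) :
    ar1WorkVar ρ d (n + 1)
      = ar1WorkVar ρ d n + 2 * (d n * ∑ j ∈ range n, ρ ^ (n - j) * d j) + d n ^ 2 := by
  unfold ar1WorkVar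
  rw [sum_range_succ]
  simp_rw [sum_range_succ]
  rw [sum_add_distrib]
  have h1 : ∀ j ∈ range n, d j * d n * ρ ^ Nat.dist j n = d n * (ρ ^ (n - j) * d j) := by
    intro j hj
    rw [Nat.dist_eq_sub_of_le (mem_range.mp hj).le]
    ring
  have h2 : ∀ k ∈ range n, d n * d k * ρ ^ Nat.dist n k = d n * (ρ ^ (n - k) * d k) := by
    intro k hk
    rw [Nat.dist_comm, Nat.dist_eq_sub_of_le (mem_range.mp hk).le]
    ring
  rw [sum_congr rfl h1, sum_congr rfl h2, Nat.dist_self, pow_zero, ← mul_sum]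
  ring

/-- **Fluctuation–dissipation identity of the model (exact, every trap path, every `ρ`).**
`Var W = 2 ⟨W⟩`: the variance of the work is twice the mean dissipated work — the Gaussian-work
relation `⟨W_d⟩ = s/2` of `Scaling/GaussianWorkDictionary` DERIVED from the dynamics rather than
imposed by Jarzynski's identity. -/
theorem ar1WorkVar_eq_two_mul_meanWork (ρ : ℝ) (d : ℕ → ℝ) (n : ℕ) :
    ar1WorkVar ρ d n = 2 * ar1MeanWork ρ d n := by
  induction n with
  | zero => simp [ar1WorkVar, ar1MeanWork]
  | succ n ih =>
      rw [ar1WorkVar_succ, ih]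
      unfold ar1MeanWork
      rw [sum_range_succ, lagSeq_eq_sum ρ d n]
      ring

/-! ## §2 The uniform protocol `m_k = k·Δ/n`: closed forms -/

/-- Constant steps `d ≡ δ`: the lag is geometric, `(1 − ρ)·e_k = δ ρ (1 − ρ^k)`. -/
theorem lagSeq_const_mul (ρ δ : ℝ) :
    ∀ k, (1 - ρ) * lagSeq ρ (fun _ => δ) k = δ * ρ * (1 - ρ ^ k)
  | 0 => by simp
  | k + 1 => by
      rw [lagSeq_succ]
      calc (1 - ρ) * (ρ * (lagSeq ρ (fun _ => δ) k + δ))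
          = ρ * ((1 - ρ) * lagSeq ρ (fun _ => δ) k) + ρ * (1 - ρ) * δ := by ring
        _ = δ * ρ * (1 - ρ ^ (k + 1)) := by rw [lagSeq_const_mul ρ δ k]; ring

/-- Constant steps: the accumulated lag, `(1 − ρ)² Σ_{k<n} e_k = (1 − ρ) ρ n δ − δ ρ (1 − ρ^n)`. -/
theorem sum_lagSeq_const_mul (ρ δ : ℝ) (n : ℕ) :
    (1 - ρ) ^ 2 * ∑ k ∈ range n, lagSeq ρ (fun _ => δ) k
      = (1 - ρ) * ρ * n * δ - δ * ρ * (1 - ρ ^ n) := by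
  have h1 := sum_lagSeq_eq ρ (fun _ => δ) n
  simp only [sum_const, card_range, nsmul_eq_mul] at h1
  calc (1 - ρ) ^ 2 * ∑ k ∈ range n, lagSeq ρ (fun _ => δ) k
      = (1 - ρ) * ((1 - ρ) * ∑ k ∈ range n, lagSeq ρ (fun _ => δ) k) := by ring
    _ = (1 - ρ) * ρ * n * δ - (1 - ρ) * lagSeq ρ (fun _ => δ) n := by rw [h1]; ring
    _ = (1 - ρ) * ρ * n * δ - δ * ρ * (1 - ρ ^ n) := by rw [lagSeq_const_mul ρ δ n]

/-- Constant steps: `⟨W⟩ = n δ²/2 + δ Σ_{k<n} e_k` (quasi-static part plus work against the lag). -/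
theorem ar1MeanWork_const (ρ δ : ℝ) (n : ℕ) :
    ar1MeanWork ρ (fun _ => δ) n = n * δ ^ 2 / 2 + δ * ∑ k ∈ range n, lagSeq ρ (fun _ => δ) k := by
  simp only [ar1MeanWork, sum_add_distrib, sum_const, card_range, nsmul_eq_mul, mul_sum]
  ring

/-- Constant steps, division-free closed form:
`(1 − ρ)² ⟨W⟩ = n δ² (1 − ρ²)/2 − δ² ρ (1 − ρ^n)`. -/
theorem ar1MeanWork_const_mul (ρ δ : ℝ) (n : ℕ) :
    (1 - ρ) ^ 2 * ar1MeanWork ρ (fun _ => δ) n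
      = n * δ ^ 2 * (1 - ρ ^ 2) / 2 - δ ^ 2 * ρ * (1 - ρ ^ n) := by
  have h := sum_lagSeq_const_mul ρ δ n
  rw [ar1MeanWork_const]
  linear_combination δ * h

/-- **The mean dissipated work of the uniform `n`-step protocol** (`ρ ≠ 1`, `n ≠ 0`, total
displacement `Δ`, steps `Δ/n`):
`⟨W⟩ = Δ²(1 + ρ)/(2n(1 − ρ)) − Δ² ρ (1 − ρ^n)/(n²(1 − ρ)²)`. -/
theorem ar1MeanWork_uniform {ρ : ℝ} (hρ : ρ ≠ 1) (Δ : ℝ) {n : ℕ} (hn : n ≠ 0) :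
    ar1MeanWork ρ (fun _ => Δ / n) n
      = Δ ^ 2 * (1 + ρ) / (2 * n * (1 - ρ)) - Δ ^ 2 * ρ * (1 - ρ ^ n) / (n ^ 2 * (1 - ρ) ^ 2) := by
  have h := ar1MeanWork_const_mul ρ (Δ / n) n
  have h1 : (1 - ρ) ≠ 0 := sub_ne_zero.mpr (Ne.symm hρ)
  have hn' : (n : ℝ) ≠ 0 := Nat.cast_ne_zero.mpr hn
  rw [show ar1MeanWork ρ (fun _ => Δ / ↑n) n
      = ((1 - ρ) ^ 2 * ar1MeanWork ρ (fun _ => Δ / ↑n) n) / (1 - ρ) ^ 2 by field_simp, h]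
  field_simp
  ring

/-- **The work variance of the uniform protocol**:
`Var W = Δ²(1 + ρ)/(n(1 − ρ)) − 2Δ² ρ (1 − ρ^n)/(n²(1 − ρ)²)`. -/
theorem ar1WorkVar_uniform {ρ : ℝ} (hρ : ρ ≠ 1) (Δ : ℝ) {n : ℕ} (hn : n ≠ 0) :
    ar1WorkVar ρ (fun _ => Δ / n) n
      = Δ ^ 2 * (1 + ρ) / (n * (1 - ρ)) - 2 * Δ ^ 2 * ρ * (1 - ρ ^ n) / (n ^ 2 * (1 - ρ) ^ 2) := by
  rw [ar1WorkVar_eq_two_mul_meanWork, ar1MeanWork_uniform hρ Δ hn]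
  have h1 : (1 - ρ) ≠ 0 := sub_ne_zero.mpr (Ne.symm hρ)
  have hn' : (n : ℝ) ≠ 0 := Nat.cast_ne_zero.mpr hn
  field_simp

/-! ## §3 The printed law `ESS = exp(−k′ n_dof/n_step)`: `k′ = Δ²(1+ρ)/(1−ρ) = Δ²·2τ_int`, with an
explicit `O(n_dof/n_step²)` correction -/

/-- **`k′` of the model**: `k′(Δ, ρ) = Δ² (1 + ρ)/(1 − ρ)` — squared thermodynamic length per
degree of freedom times `2 τ_int` of the autoregression (`kPrime_eq_tauInt`). -/
noncomputable def kPrime (Δ ρ : ℝ) : ℝ :=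
  Δ ^ 2 * ((1 + ρ) / (1 - ρ))

/-- `k′ = Δ² · 2 τ_int`, where `τ_int = (1 + ρ)/(2(1 − ρ))` is the integrated autocorrelation time
of the AR(1) autocorrelation function `t ↦ ρ^t` (`Scoring.tauInt_geometric`, calibration set C-1
of the frozen scorers). -/
theorem kPrime_eq_tauInt (Δ : ℝ) {ρ : ℝ} (hρ : |ρ| < 1) :
    kPrime Δ ρ = Δ ^ 2 * (2 * tauInt (fun t => ρ ^ t)) := by
  rw [kPrime, tauInt_geometric hρ]
  have h1 : (1 : ℝ) - ρ ≠ 0 := by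
    have := (abs_lt.mp hρ).2
    exact ne_of_gt (by linarith)
  field_simp

/-- Perfect relaxation: `k′(Δ, 0) = Δ²` — the thermodynamic-length / perfect-relaxation law
`ESS = exp(−Λ²/n)`, `Λ² = n_dof Δ²` (T2-W, `Scaling/PerfectRelaxationVolume`, row 8's
`QuasiStaticFloorLaw`). -/
@[simp] theorem kPrime_rho_zero (Δ : ℝ) : kPrime Δ 0 = Δ ^ 2 := by
  simp [kPrime]

/-- `k′` is strictly increasing in the autocorrelation `ρ < 1` (for `Δ ≠ 0`). -/
theorem kPrime_lt_kPrime {Δ : ℝ} (hΔ : Δ ≠ 0) {ρ₁ ρ₂ : ℝ} (h : ρ₁ < ρ₂) (h2 : ρ₂ < 1) :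
    kPrime Δ ρ₁ < kPrime Δ ρ₂ := by
  unfold kPrime
  refine mul_lt_mul_of_pos_left ?_ (by positivity)
  rw [div_lt_div_iff₀ (by linarith) (by linarith)]
  nlinarith

/-- Over-relaxation beats perfect relaxation to leading order, under-relaxation loses:
`k′(Δ, ρ) < Δ² ↔ ρ < 0` (for `Δ ≠ 0`, `ρ < 1`). -/
theorem kPrime_lt_sq_iff {Δ : ℝ} (hΔ : Δ ≠ 0) {ρ : ℝ} (h1 : ρ < 1) :
    kPrime Δ ρ < Δ ^ 2 ↔ ρ < 0 := by
  constructor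
  · intro h
    by_contra hρ
    push Not at hρ
    rcases hρ.eq_or_lt with rfl | hlt
    · simp at h
    · have := kPrime_lt_kPrime hΔ hlt h1
      rw [kPrime_rho_zero] at this
      linarith
  · intro h
    have := kPrime_lt_kPrime hΔ h one_pos
    rwa [kPrime_rho_zero] at this

/-- `0 ≤ k′` on the physical range `−1 ≤ ρ < 1`. -/
theorem kPrime_nonneg (Δ : ℝ) {ρ : ℝ} (h1 : -1 ≤ ρ) (h2 : ρ < 1) : 0 ≤ kPrime Δ ρ :=
  mul_nonneg (sq_nonneg Δ) (div_nonneg (by linarith) (by linarith))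

/-- **`−log ESS` of the model** for `N = n_dof` independent degrees of freedom, each dragged through
`Δ` by the uniform `n`-step protocol: `N · Var W₁`.  DICTIONARY (not re-proved here): the work is
Gaussian, so the population Kish ESS is `exp(−Var W)` (`Theory2.gaussianWork_kishESS` in
`Scaling/GaussianWorkDictionary`), and independent degrees of freedom add their work variances. -/
noncomputable def ar1NegLogESS (N Δ ρ : ℝ) (n : ℕ) : ℝ :=
  N * ar1WorkVar ρ (fun _ => Δ / n) n

/-- **THE LAW.** `−log ESS = k′·n_dof/n_step − n_dof · 2Δ²ρ(1 − ρ^n)/(n_step²(1 − ρ)²)`: Bonanno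
et al.'s fitted `ESS = exp(−k′ n_dof/n_step)` (arXiv:2510.25704 eq. (3.9)) is EXACT in the model to
leading order in `1/n_step`, with `k′ = Δ²(1+ρ)/(1−ρ)` and an explicit second-order correction. -/
theorem ar1NegLogESS_eq {ρ : ℝ} (hρ : ρ ≠ 1) (N Δ : ℝ) {n : ℕ} (hn : n ≠ 0) :
    ar1NegLogESS N Δ ρ n
      = kPrime Δ ρ * N / n - N * (2 * Δ ^ 2 * ρ * (1 - ρ ^ n) / (n ^ 2 * (1 - ρ) ^ 2)) := by
  rw [ar1NegLogESS, ar1WorkVar_uniform hρ Δ hn, kPrime]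
  have h1 : (1 - ρ) ≠ 0 := sub_ne_zero.mpr (Ne.symm hρ)
  have hn' : (n : ℝ) ≠ 0 := Nat.cast_ne_zero.mpr hn
  field_simp

/-- Under-relaxed layers (`0 ≤ ρ < 1`): the correction is non-negative, so the printed law is a
FLOOR on the ESS, `−log ESS ≤ k′ n_dof/n_step`. -/
theorem ar1NegLogESS_le {ρ : ℝ} (h0 : 0 ≤ ρ) (h1 : ρ < 1) {N : ℝ} (hN : 0 ≤ N) (Δ : ℝ) {n : ℕ}
    (hn : n ≠ 0) : ar1NegLogESS N Δ ρ n ≤ kPrime Δ ρ * N / n := by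
  rw [ar1NegLogESS_eq h1.ne N Δ hn]
  have hpow : ρ ^ n ≤ 1 := pow_le_one₀ h0 h1.le
  have : 0 ≤ N * (2 * Δ ^ 2 * ρ * (1 - ρ ^ n) / (n ^ 2 * (1 - ρ) ^ 2)) := by
    apply mul_nonneg hN
    apply div_nonneg
    · exact mul_nonneg (by positivity) (sub_nonneg.mpr hpow)
    · positivity
  linarith

/-- … and the floor is sharp to `O(n_dof/n_step²)`:
`k′ n_dof/n_step − 2 n_dof Δ² ρ/(n_step²(1 − ρ)²) ≤ −log ESS` (`0 ≤ ρ < 1`). -/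
theorem ar1NegLogESS_ge {ρ : ℝ} (h0 : 0 ≤ ρ) (h1 : ρ < 1) {N : ℝ} (hN : 0 ≤ N) (Δ : ℝ) {n : ℕ}
    (hn : n ≠ 0) :
    kPrime Δ ρ * N / n - N * (2 * Δ ^ 2 * ρ / (n ^ 2 * (1 - ρ) ^ 2)) ≤ ar1NegLogESS N Δ ρ n := by
  rw [ar1NegLogESS_eq h1.ne N Δ hn]
  have hpow : 0 ≤ ρ ^ n := pow_nonneg h0 n
  have : N * (2 * Δ ^ 2 * ρ * (1 - ρ ^ n) / (n ^ 2 * (1 - ρ) ^ 2))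
      ≤ N * (2 * Δ ^ 2 * ρ / (n ^ 2 * (1 - ρ) ^ 2)) := by
    apply mul_le_mul_of_nonneg_left _ hN
    apply div_le_div_of_nonneg_right _ (by positivity)
    have : 0 ≤ 2 * Δ ^ 2 * ρ := by positivity
    nlinarith
  linarith

/-- Over-relaxed layers (`−1 ≤ ρ ≤ 0`): the correction changes sign, the printed law becomes a
CEILING on the ESS, `k′ n_dof/n_step ≤ −log ESS` — with the smaller `k′ < Δ²`. -/
theorem ar1NegLogESS_ge_of_nonpos {ρ : ℝ} (h0 : ρ ≤ 0) (h1 : -1 ≤ ρ) {N : ℝ} (hN : 0 ≤ N) (Δ : ℝ)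
    {n : ℕ} (hn : n ≠ 0) : kPrime Δ ρ * N / n ≤ ar1NegLogESS N Δ ρ n := by
  rw [ar1NegLogESS_eq (by linarith) N Δ hn]
  have hpow : ρ ^ n ≤ 1 := by
    calc ρ ^ n ≤ |ρ ^ n| := le_abs_self _
      _ = |ρ| ^ n := abs_pow ρ n
      _ ≤ 1 := pow_le_one₀ (abs_nonneg ρ) (abs_le.mpr ⟨by linarith, by linarith⟩)
  have : N * (2 * Δ ^ 2 * ρ * (1 - ρ ^ n) / (n ^ 2 * (1 - ρ) ^ 2)) ≤ 0 := by
    apply mul_nonpos_of_nonneg_of_nonpos hN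
    apply div_nonpos_of_nonpos_of_nonneg
    · have : 2 * Δ ^ 2 * ρ * (1 - ρ ^ n) = (2 * Δ ^ 2) * (ρ * (1 - ρ ^ n)) := by ring
      rw [this]
      exact mul_nonpos_of_nonneg_of_nonpos (by positivity)
        (mul_nonpos_of_nonpos_of_nonneg h0 (sub_nonneg.mpr hpow))
    · positivity
  linarith

/-- The ESS form of the floor (`0 ≤ ρ < 1`): `exp(−k′ n_dof/n_step) ≤ ESS`. -/
theorem exp_neg_kPrime_le_ess {ρ : ℝ} (h0 : 0 ≤ ρ) (h1 : ρ < 1) {N : ℝ} (hN : 0 ≤ N) (Δ : ℝ)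
    {n : ℕ} (hn : n ≠ 0) :
    Real.exp (-(kPrime Δ ρ * N / n)) ≤ Real.exp (-ar1NegLogESS N Δ ρ n) :=
  Real.exp_le_exp.mpr (neg_le_neg (ar1NegLogESS_le h0 h1 hN Δ hn))

/-- **The collapse.** `n_step · (−log ESS) → k′ · n_dof` as `n_step → ∞`, for every `|ρ| < 1`:
asymptotically the ESS is a function of `n_step/n_dof` alone, through the printed law. -/
theorem tendsto_ar1NegLogESS {ρ : ℝ} (hρ : |ρ| < 1) (N Δ : ℝ) :
    Tendsto (fun n : ℕ => (n : ℝ) * ar1NegLogESS N Δ ρ n) atTop (𝓝 (kPrime Δ ρ * N)) := by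
  have hρ1 : ρ ≠ 1 := by
    have := (abs_lt.mp hρ).2
    exact ne_of_lt this
  have h1 : (1 : ℝ) - ρ ≠ 0 := sub_ne_zero.mpr (Ne.symm hρ1)
  -- the correction `C · (1 − ρ^n)/n → 0`
  have hcorr : Tendsto (fun n : ℕ => N * (2 * Δ ^ 2 * ρ / (1 - ρ) ^ 2) * ((1 - ρ ^ n) * (1 / (n : ℝ))))
      atTop (𝓝 0) := by
    have hp : Tendsto (fun n : ℕ => ρ ^ n) atTop (𝓝 0) :=
      tendsto_pow_atTop_nhds_zero_of_abs_lt_one hρ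
    have h2 : Tendsto (fun n : ℕ => (1 - ρ ^ n) * (1 / (n : ℝ))) atTop (𝓝 ((1 - 0) * 0)) :=
      ((tendsto_const_nhds.sub hp).mul tendsto_one_div_atTop_nhds_zero_nat)
    rw [sub_zero, one_mul] at h2
    simpa using h2.const_mul (N * (2 * Δ ^ 2 * ρ / (1 - ρ) ^ 2))
  have hmain : Tendsto (fun n : ℕ => kPrime Δ ρ * N
      - N * (2 * Δ ^ 2 * ρ / (1 - ρ) ^ 2) * ((1 - ρ ^ n) * (1 / (n : ℝ)))) atTop
      (𝓝 (kPrime Δ ρ * N)) := by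
    simpa using (tendsto_const_nhds.sub hcorr)
  refine hmain.congr' ?_
  filter_upwards [eventually_gt_atTop 0] with n hn
  have hn' : (n : ℝ) ≠ 0 := Nat.cast_ne_zero.mpr (Nat.pos_iff_ne_zero.mp hn)
  rw [ar1NegLogESS_eq hρ1 N Δ (Nat.pos_iff_ne_zero.mp hn)]
  field_simp

end Summit.Ventures.LatticeQCDFlow.Scaling
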